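import Summits.QuantumFields.YangMills.Theorems.BalabanUVNodesN14AtRecord
import Summits.QuantumFields.YangMills.Theorems.BalabanUVNodesRateCarriersOfRecord13CoOn

/-!
# DAG node N14 · NE1′ — THE K4 STUB `YMDAG.UVSplit.S_N14` AT THE STAGE-13 TUPLE-KEYED, REGIME-RESTRICTED RATE-RECORD HOME OF RECORD `RRec₁₃CoOn 𝔯 Rg` (the `Co`
# edition: RECORD 13 re-based at print's background `UbgOfRecord₁₃Co`, director-ym №152 RULING (β); KEY-RULE-21): the KNIT of the row from the dressing estimate at
# every guarded admissible tuple, its slot form (END-B by name), its dependence on `𝔯.ne1` ONLY, and the record census' regression test (toy ∕ doubling towers) —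
# the ONE-TOKEN `Co` TWIN of `BalabanUVNodesN14AtRateRecord13On` (p496675), by ONE application each on dag-n22-e's `s_N14_rRec₁₃CoOn_iff`

Cell `pub-ymgap`, YM-PLAN Track A (HUMAN RULING D-0062), R134 acceleration seat `pub-ymgap-dag-n14-c` (generation 7; ROW B of dag-lead g8's ORPHAN-STOREYS l.18132,
claimed by this live pen l.18160 — DEDUP-266 (1): ONE twin per lineage on the Co datum road).  The MECHANICAL `Co` RE-KEY (director-ym №152 (β) §4 «key ONCE, on
Core(Co)»; def-T `Node00/Record13Co.lean` p515035 ✓ + KEY-21C l.18076; RR-2 `Node00/Record13DatumKeyCo` p515777 ✓; dag-n22-e's bg-free-keyed rate homes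
`BalabanUVNodesRateCarriersOfRecord13Co` p516685 ✓ and `BalabanUVNodesRateCarriersOfRecord13CoOn` p517309 ✓ (LANDED-CO l.18483: «your LAST re-key … is `Sep ↦ Co` on the
stems; binder `(hc : θ.Provisos₁₃Core F N)`; at an item tuple pass `h.toCore`»)) has LANDED, so this file is the token twin of p496675 under n22-e's map, read off the
diff of its two homes: `RRec₁₃(On) ↦ RRec₁₃Co(On)`, `rRec₁₃… ↦ rRec₁₃Co…`, `RateReading₁₃ ↦ RateReading₁₃Co`, `rateCarriersOfRecord₁₃ ↦ rateCarriersOfRecord₁₃Co`,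
`(Is|is)DatumOfRecord₁₃C ↦ …₁₃CCo`, `datumOfRecord₁₃ ↦ datumOfRecord₁₃Co`, binder `θ.Provisos₁₃ ↦ θ.Provisos₁₃Core` (the UNCHANGED background-free proviso structure);
rev 16's guard of record `Node00.unityNondeg₁₃ N` (`θ.ZtUnity F N ∧ θ.SlotsNondegenerate₁₃ F N`) is background-free and UNCHANGED.  THEOREMS ONLY (0 `def`, 0 `sorry`,
standard axioms); imports dag-n14-a's refinement-generic closer of record `BalabanUVNodesN14AtRecord` (p419066: `s_N14_antitone`, `n14At_of_uniformLeaves`, `n14At_toyTower`,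
`not_n14At_growing_one` — generic in `RRec`, they apply at `RRec := RRec₁₃CoOn 𝔯 Rg` VERBATIM and are not restated) and the Co home (through it layer B Co, RR-2's key
`Node00/Record13DatumKeyCo`, def-T's `Node00/Record13Co`); modifies nothing; `--supports` K3⁗ `SpineGivenEndpointR13Sep` (stmt-QuantumFields-20292) `--as helper`
(K3⁵ after KEY-20 reads the Co datum by `rfl` through `Provisos₁₃SepCo.toCore`, plan CORE-YES l.17420 ∕ ANSWER-152-§5).  The ⁗-`Sep` sibling
`BalabanUVNodesN14AtRateRecord13SepOn` (p506090) and the ‴ edition p496675 STAND as theorems at their editions (no successor needed: n22-e files no `SepCo` rate home).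

THE SITUATION AT ₁₃.  `RRec₁₃CoOn 𝔯 Rg : RateRecordPred N` pins, at `(F, D, g₀, os)`, the bundles `rateCarriersOfRecord₁₃Co 𝔯 F θ hP g₀ os k` of EVERY admissible Stage-13
tuple `θ` with provisos `hP` IN THE REGIME `Rg F θ` whose datum of record is `D`, read AT `θ` (a K3⁗∕K3⁵ composer spells rev 16's guard as the regime:
`Rg := Node00.unityNondeg₁₃ N`, i.e. `θ.ZtUnity F N ∧ θ.SlotsNondegenerate₁₃ F N` — the home's §4); its N14 face `s_N14_rRec₁₃CoOn_iff` (n22-e) reads: `S_N14 (RRec₁₃CoOn 𝔯 Rg) ↔ ∀ F θ hP, Rg F θ →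
θ.Admissible F N → ∀ g₀ os, N14At (𝔯.ne1 F θ hP g₀ os)`.  The dressed-tower assignment `𝔯.ne1` is RESIDUAL (NODE O's object); this file supplies the row's knit and
census AT THAT FACE:
* §1 **`s_N14_rRec₁₃CoOn_of_n14At`** — THE KNIT: the dressing estimate `∀ F θ hP, Rg F θ → θ.Admissible → ∀ g₀ os, N14At (𝔯.ne1 F θ hP g₀ os)` (the s1 target type for the
  reading's assignment, guarded) gives `S_N14 (RRec₁₃CoOn 𝔯 Rg)`; `n14At_of_s_N14_rRec₁₃CoOn` (converse read-out at a guarded tuple); **`s_N14_rRec₁₃CoOn_of_uniformLeaves`** ∕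
  `…_of_one` — the same from the SLOT (ONE application of `n14At_of_uniformLeaves`, END-B `dressedStabilityStrict_of_bookingLeaves` by name) resp. from ONE
  `U : UniformConstants` serving every guarded tuple.
* §2 regime glue: `s_N14_rRec₁₃CoOn_anti` (a larger regime's stub gives a smaller one's — `k4_rRec₁₃CoOn_anti`.1), `s_N14_rRec₁₃Co_of_rRec₁₃CoOn_true` (the tuple-keyed stub at the
  trivial regime gives the CANONICAL home's `S_N14 (RRec₁₃Co 𝔯)`), `s_N14_rRec₁₃CoOn_iff_of_ne1_eq` (the stub does not read `𝔯.lit`: nothing of U3 ∕ N15 ∕ N16 bears on N14 here),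
  `s_N14_rRec₁₃CoOn_unityNondeg_of_n14At` (the knit at rev 16's GUARD OF RECORD `Node00.unityNondeg₁₃ N` = `θ.ZtUnity F N ∧ θ.SlotsNondegenerate₁₃ F N` as the regime — an
  instance, one line; its binder prefix IS the K3 skeleton's `KeyedRates` prefix restricted to N14, cf. the home's `rateStub_rRec₁₃CoOn_unityNondeg_iff`).
* §3 the census' regression test at ₁₃: `not_s_N14_rRec₁₃CoOn_of_hits_growing` (a reading whose `ne1` hits the doubling tower `⟨Unit, growingTower, 1⟩` at ONE guarded
  admissible tuple has NO `S_N14`), `s_N14_rRec₁₃CoOn_of_toy` (the constant TOY assignment closes it with no content), **`s_N14_rRec₁₃CoOn_depends_on_ne1`** (given one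
  guarded admissible tuple with provisos, two readings with the SAME Literature-typed rate objects `lit` differ on `S_N14` — the stub is a statement ABOUT `𝔯.ne1`,
  decided by nothing in the home).

HONEST FRAMING.  Count-neutral kernel bookkeeping (one-application knits over a RESIDUAL assignment); a K3 skeleton quoting `S_N14 (RRec₁₃CoOn 𝔯 Rg)` NAMES its `𝔯.ne1`, and
the stub is contentful exactly for `𝔯.ne1` = the dressed tower OF RECORD (absent; NODE O), junk-true for the toy assignment, false for the doubling one; unlike the ₁₁
home (`Provisos₁₁` uninhabited, def-T `not_provisos₁₁` — dag-ref-B ADDENDUM-1) the ₁₃ faces are NOT vacuous by construction (K0‴ `Record13Inhabited` is the open crux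
stmt-QuantumFields-19909, vetted, not refuted).  N14 NOT discharged (typed 28∕28 · discharged 5∕28 unmoved); NE1′ NOT PRINTED ([Balaban1989LargeFieldII] (1.73)–(1.75)
pp. 379–380 type the action only) and NOT PROVED; nothing of Bałaban's is asserted or denied at his objects.  One finite four-torus programme at fixed `ε` — NOT
infinite volume, NOT OS on ℝ⁴, NOT a mass gap, NOT Clay.
-/

noncomputable section

namespace YMDAG.N14

open Literature.MathematicalPhysics.QuantumFieldTheory.Balaban1983to89
open Literature.MathematicalPhysics.QuantumFieldTheory.Balaban1983to89.T4Continuum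
open Summit.QuantumFields.BalabanUV.T4Continuum.NE1p.DressedRoot
open Summit.QuantumFields.BalabanUV.T4Continuum.NE1p.DressedRootStrictSeparation
open YMDAG.UVSplit
open Node00 (Stage13Params datumOfRecord₁₃Co IsDatumOfRecord₁₃CCo RateObjects₁₁)

variable {N : ℕ} [NeZero N] (𝔯 : RateReading₁₃Co N) (Rg : (F : T4Family) → Stage13Params F N → Prop)

/-! ## §1 The knit of the row at the guarded θ-form -/

section Knit

/-- **THE KNIT OF THE ROW AT ₁₃** [bookkeeping]: the dressing estimate for the reading's dressed-tower assignment at EVERY admissible Stage-13 tuple with provisos in the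
regime — `N14At (𝔯.ne1 F θ hP g₀ os)` — gives the K4 stub `S_N14 (RRec₁₃CoOn 𝔯 Rg)` (dag-n22-e's `s_N14_rRec₁₃CoOn_iff`, ONE application). [folklore] -/
theorem s_N14_rRec₁₃CoOn_of_n14At
    (h : ∀ (F : T4Family) (θ : Stage13Params F N) (hP : θ.Provisos₁₃Core F N), Rg F θ → θ.Admissible F N →
      ∀ (g₀ : ℕ → ℝ) (os : List (ULoop F)), N14At (𝔯.ne1 F θ hP g₀ os)) :
    S_N14 (RRec₁₃CoOn 𝔯 Rg) :=
  (s_N14_rRec₁₃CoOn_iff 𝔯 Rg).mpr h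

/-- **READ-OUT** [bookkeeping]: the stub at the regime-restricted home gives NE1′ for the reading's assignment at every admissible tuple with provisos in the regime. -/
theorem n14At_of_s_N14_rRec₁₃CoOn (h : S_N14 (RRec₁₃CoOn 𝔯 Rg)) {F : T4Family} (θ : Stage13Params F N) (hP : θ.Provisos₁₃Core F N) (hRg : Rg F θ)
    (hθ : θ.Admissible F N) (g₀ : ℕ → ℝ) (os : List (ULoop F)) : N14At (𝔯.ne1 F θ hP g₀ os) :=
  (s_N14_rRec₁₃CoOn_iff 𝔯 Rg).mp h F θ hP hRg hθ g₀ os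

/-- **THE KNIT FROM THE SLOT** [bookkeeping]: uniform leaves (END-B) for the reading's dressed tower at every guarded admissible tuple, with `U.Λ` the carriers' rate,
give `S_N14 (RRec₁₃CoOn 𝔯 Rg)` — ONE application of dag-n14-a's `n14At_of_uniformLeaves` (`dressedStabilityStrict_of_bookingLeaves` by name). [folklore] -/
theorem s_N14_rRec₁₃CoOn_of_uniformLeaves
    (h : ∀ (F : T4Family) (θ : Stage13Params F N) (hP : θ.Provisos₁₃Core F N), Rg F θ → θ.Admissible F N → ∀ (g₀ : ℕ → ℝ) (os : List (ULoop F)),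
      ∃ U : UniformConstants, U.Λ = (𝔯.ne1 F θ hP g₀ os).Λ ∧
        ∀ p K, Nonempty (BookingLeaves U ((𝔯.ne1 F θ hP g₀ os).𝒯.B p K) ((𝔯.ne1 F θ hP g₀ os).𝒯.T p K))) :
    S_N14 (RRec₁₃CoOn 𝔯 Rg) :=
  s_N14_rRec₁₃CoOn_of_n14At 𝔯 Rg fun F θ hP hRg hθ g₀ os => n14At_of_uniformLeaves _ (h F θ hP hRg hθ g₀ os)

/-- **… FROM ONE `U : UniformConstants` FOR THE WHOLE REGIME** [bookkeeping]: leaves at `U` for every guarded admissible tuple and the carriers' rates pinned into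
`[0, U.Λ]` (dag-n14-a's `s_N14_of_one`, generic in the record predicate, read at `RRec₁₃CoOn 𝔯 Rg`). [folklore] -/
theorem s_N14_rRec₁₃CoOn_of_one (U : UniformConstants)
    (hL : ∀ (F : T4Family) (θ : Stage13Params F N) (hP : θ.Provisos₁₃Core F N), Rg F θ → θ.Admissible F N → ∀ (g₀ : ℕ → ℝ) (os : List (ULoop F)),
      ∀ p K, Nonempty (BookingLeaves U ((𝔯.ne1 F θ hP g₀ os).𝒯.B p K) ((𝔯.ne1 F θ hP g₀ os).𝒯.T p K)))
    (hΛ : ∀ (F : T4Family) (θ : Stage13Params F N) (hP : θ.Provisos₁₃Core F N), Rg F θ → θ.Admissible F N → ∀ (g₀ : ℕ → ℝ) (os : List (ULoop F)),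
      0 ≤ (𝔯.ne1 F θ hP g₀ os).Λ ∧ (𝔯.ne1 F θ hP g₀ os).Λ ≤ U.Λ) :
    S_N14 (RRec₁₃CoOn 𝔯 Rg) := by
  refine s_N14_of_one (RRec₁₃CoOn 𝔯 Rg) U (fun F D g₀ os R hR => ?_) (fun F D g₀ os R hR => ?_)
  · obtain ⟨θ, hP, hRg, hθ, -, k, rfl⟩ := hR
    exact hL F θ hP hRg hθ g₀ os
  · obtain ⟨θ, hP, hRg, hθ, -, k, rfl⟩ := hR
    exact hΛ F θ hP hRg hθ g₀ os

end Knit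

/-! ## §2 Regime glue: antitone in the regime, down to the canonical home, blind to `𝔯.lit` -/

section Glue

/-- **A LARGER REGIME'S STUB GIVES A SMALLER ONE'S** [bookkeeping] (dag-n22-e's `k4_rRec₁₃CoOn_anti`, N14 component). [folklore] -/
theorem s_N14_rRec₁₃CoOn_anti {Rg Rg' : (F : T4Family) → Stage13Params F N → Prop} (h : ∀ F θ, Rg F θ → Rg' F θ) :
    S_N14 (RRec₁₃CoOn 𝔯 Rg') → S_N14 (RRec₁₃CoOn 𝔯 Rg) :=
  (k4_rRec₁₃CoOn_anti 𝔯 h).1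

/-- **DOWN TO THE CANONICAL HOME** [bookkeeping]: the tuple-keyed stub at the trivial regime gives `S_N14 (RRec₁₃Co 𝔯)` (the canonical parameter of a datum of record is one
admissible tuple with provisos — `rRec₁₃Co_le_rRec₁₃CoOn_true` + dag-n14-a's `s_N14_antitone`). [folklore] -/
theorem s_N14_rRec₁₃Co_of_rRec₁₃CoOn_true (h : S_N14 (RRec₁₃CoOn 𝔯 fun _ _ => True)) : S_N14 (RRec₁₃Co 𝔯) :=
  s_N14_antitone (fun _ _ _ _ _ hR => rRec₁₃Co_le_rRec₁₃CoOn_true 𝔯 hR) h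

/-- **… AND TO EVERY REGIME** [bookkeeping]: the stub at the trivial regime gives the stub at any regime. [folklore] -/
theorem s_N14_rRec₁₃CoOn_of_true (h : S_N14 (RRec₁₃CoOn 𝔯 fun _ _ => True)) : S_N14 (RRec₁₃CoOn 𝔯 Rg) :=
  s_N14_rRec₁₃CoOn_anti 𝔯 (fun _ _ _ => trivial) h

/-- **THE STUB DOES NOT READ `𝔯.lit`** [bookkeeping]: two readings with the same dressed-tower assignment have the same `S_N14` at every regime — nothing of node U3 ∕
N15 ∕ N16 (the Literature-typed rate objects) bears on N14 at the home. [folklore] -/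
theorem s_N14_rRec₁₃CoOn_iff_of_ne1_eq {𝔯 𝔯' : RateReading₁₃Co N}
    (h : ∀ (F : T4Family) (θ : Stage13Params F N) (hP : θ.Provisos₁₃Core F N) (g₀ : ℕ → ℝ) (os : List (ULoop F)),
      𝔯.ne1 F θ hP g₀ os = 𝔯'.ne1 F θ hP g₀ os) :
    S_N14 (RRec₁₃CoOn 𝔯 Rg) ↔ S_N14 (RRec₁₃CoOn 𝔯' Rg) := by
  rw [s_N14_rRec₁₃CoOn_iff, s_N14_rRec₁₃CoOn_iff]
  constructor
  · intro hS F θ hP hRg hθ g₀ os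
    rw [← h F θ hP g₀ os]
    exact hS F θ hP hRg hθ g₀ os
  · intro hS F θ hP hRg hθ g₀ os
    rw [h F θ hP g₀ os]
    exact hS F θ hP hRg hθ g₀ os

/-- **AT REV 16's GUARD OF RECORD** [bookkeeping]: the K3 text (‴ 19912 ∕ ⁗ 20292, unchanged at the Co edition) guards the tuple by `θ.ZtUnity F N ∧ θ.SlotsNondegenerate₁₃ F N` = RR-2's
`Node00.unityNondeg₁₃ N`; with that conjunction as the regime, the knit reads: the dressing estimate at every admissible tuple with provisos satisfying unity and
slot non-degeneracy gives `S_N14 (RRec₁₃CoOn 𝔯 (Node00.unityNondeg₁₃ N))` (one-liner on §1; the guard is spelled here only as an instance — regimes stay parameters;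
the hypothesis is the N14 conjunct of the skeleton's `KeyedRates` prefix for a reading pinned to `𝔯.ne1`). [folklore] -/
theorem s_N14_rRec₁₃CoOn_unityNondeg_of_n14At
    (h : ∀ (F : T4Family) (θ : Stage13Params F N) (hP : θ.Provisos₁₃Core F N), θ.ZtUnity F N → θ.SlotsNondegenerate₁₃ F N → θ.Admissible F N →
      ∀ (g₀ : ℕ → ℝ) (os : List (ULoop F)), N14At (𝔯.ne1 F θ hP g₀ os)) :
    S_N14 (RRec₁₃CoOn 𝔯 (Node00.unityNondeg₁₃ N)) :=
  s_N14_rRec₁₃CoOn_of_n14At 𝔯 _ fun F θ hP hRg hθ g₀ os => h F θ hP hRg.1 hRg.2 hθ g₀ os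

end Glue

/-! ## §3 The record census' regression test at ₁₃: toy and doubling assignments -/

section Census

/-- **A READING WHOSE `ne1` HITS THE DOUBLING TOWER AT ONE GUARDED ADMISSIBLE TUPLE HAS NO `S_N14`** [decided probe]: `⟨Unit, growingTower, 1⟩` fails NE1′
(dag-n14-a's `not_n14At_growing_one`). [folklore] -/
theorem not_s_N14_rRec₁₃CoOn_of_hits_growing {F : T4Family} (θ : Stage13Params F N) (hP : θ.Provisos₁₃Core F N) (hRg : Rg F θ) (hθ : θ.Admissible F N)
    (g₀ : ℕ → ℝ) (os : List (ULoop F)) (h : 𝔯.ne1 F θ hP g₀ os = ⟨Unit, growingTower, 1⟩) : ¬ S_N14 (RRec₁₃CoOn 𝔯 Rg) := by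
  intro hS
  have h14 := n14At_of_s_N14_rRec₁₃CoOn 𝔯 Rg hS θ hP hRg hθ g₀ os
  rw [h] at h14
  exact not_n14At_growing_one h14

/-- **THE CONSTANT TOY ASSIGNMENT CLOSES THE STUB WITH NO CONTENT** [decided probe]: `⟨Unit, toyTower, 2⟩` satisfies NE1′ (dag-n14-a's `n14At_toyTower`). [folklore] -/
theorem s_N14_rRec₁₃CoOn_of_toy
    (h : ∀ (F : T4Family) (θ : Stage13Params F N) (hP : θ.Provisos₁₃Core F N) (g₀ : ℕ → ℝ) (os : List (ULoop F)),
      𝔯.ne1 F θ hP g₀ os = ⟨Unit, toyTower, 2⟩) :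
    S_N14 (RRec₁₃CoOn 𝔯 Rg) :=
  s_N14_rRec₁₃CoOn_of_n14At 𝔯 Rg fun F θ hP _ _ g₀ os => by rw [h F θ hP g₀ os]; exact n14At_toyTower

/-- **THE STUB IS A STATEMENT ABOUT `𝔯.ne1`, DECIDED BY NOTHING IN THE HOME** [decided probe]: given ONE admissible tuple with provisos in the regime (for some family),
there are two readings with the SAME Literature-typed rate objects `lit`, one with `S_N14` and one without. [folklore] -/
theorem s_N14_rRec₁₃CoOn_depends_on_ne1 (lit : (F : T4Family) → (θ : Stage13Params F N) → θ.Provisos₁₃Core F N → (ℕ → ℝ) → List (ULoop F) → RateObjects₁₁ N)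
    (hinh : ∃ (F : T4Family) (θ : Stage13Params F N) (_ : θ.Provisos₁₃Core F N), Rg F θ ∧ θ.Admissible F N) :
    ∃ 𝔯₁ 𝔯₂ : RateReading₁₃Co N, 𝔯₁.lit = lit ∧ 𝔯₂.lit = lit ∧ S_N14 (RRec₁₃CoOn 𝔯₁ Rg) ∧ ¬ S_N14 (RRec₁₃CoOn 𝔯₂ Rg) := by
  obtain ⟨F, θ, hP, hRg, hθ⟩ := hinh
  refine ⟨⟨lit, fun _ _ _ _ _ => ⟨Unit, toyTower, 2⟩⟩, ⟨lit, fun _ _ _ _ _ => ⟨Unit, growingTower, 1⟩⟩, rfl, rfl,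
    s_N14_rRec₁₃CoOn_of_toy _ Rg (fun _ _ _ _ _ => rfl), ?_⟩
  exact not_s_N14_rRec₁₃CoOn_of_hits_growing _ Rg θ hP hRg hθ (fun _ => 0) [] rfl

end Census

end YMDAG.N14

end
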